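import Literature.NumberTheory.Automorphic.LocalLanglandsGLOne
import Literature.NumberTheory.Automorphic.TateLocalFactorsProofs
import Literature.NumberTheory.Automorphic.LocalConstantsTwistProofs
import Literature.NumberTheory.GaloisRepresentations.WeilDeligneRepProofs
import HarnessLib

/-!
# Stub `stub_eulerFactor_ofQuasiCharOn_tprod` for line `Sketch_18745_r1_k1`
(crux stmt-Langlands-18745)

The Euler factor of a tensor product of two quasi-character lines is Tate's local factor
polynomial of the product character: for complex lines `V`, `V₁` and quasi-characters `α`, `χ`
of `Fˣ`,

  `eulerFactor ((α ∘ artin on V, 0) ⊗ (χ ∘ artin on V₁, 0)) = P_{αχ}(T)`,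

where `P_η = 1 - η(ϖ) T` for unramified `η` and `P_η = 1` otherwise (`tateEulerFactor`).

Proof.  The Weil group acts on the line `V ⊗ V₁` by the scalar `(αχ)(artin w)` and the monodromy
is `0`.  If `αχ` is unramified it kills `artin(I_F) ⊆ {|x|_F = 1}`, so `(ker N)^{I_F}` is the whole
line, the matrix of a geometric Frobenius `Φ` in a basis of it is the `1 × 1` matrix
`((αχ)(artin Φ))`, whose reversed characteristic polynomial is `1 - (αχ)(artin Φ) T`; and
`artin Φ` is a uniformiser (Deligne's normalisation `LocalArtinData.artin_frob`), so this is
`P_{αχ}` by `tateEulerFactor_of_isUnramified_holds`.  If `αχ` is ramified, some unit `x` of norm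
`1` has `(αχ)(x) ≠ 1`; `x = artin u` with `u ∈ I_F` (`LocalArtinData.image_inertia`), and `u` acts
on the line by the scalar `(αχ)(x) ≠ 1`, so `(ker N)^{I_F} = 0` and the Euler factor is the
determinant of a `0 × 0` matrix, `1 = P_{αχ}`.

References: J. Tate, *Number theoretic background*, Corvallis 1979, (4.1.6); J. Tate, *Fourier
analysis in number fields and Hecke's zeta-functions* (1950), §2.4.
-/

set_option linter.dupNamespace false -- `Summit.Langlands.Langlands` is the mandated namespace

noncomputable section

open scoped TensorProduct
open Module Polynomial
open Literature.NumberTheory.Automorphic Literature.NumberTheory.GaloisRepresentations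
open Literature.NumberTheory.GaloisRepresentations.IsNonarchimedeanLocalField (normAbs)

namespace Summit.Langlands.Langlands.Theorems.ReciprocityRigidity

variable {F : Type} [Field F] [ValuativeRel F] [TopologicalSpace F] [IsNonarchimedeanLocalField F]

section ScalarLine

variable {W : Type*} [AddCommGroup W] [Module ℂ W] [FiniteDimensional ℂ W]

/-- `(ker N)^{I_F} = 0` forces the Euler factor `det(1 - T·ρ(Φ) | (ker N)^{I_F})` to be `1`
(determinant of a `0 × 0` matrix). [cite: TateCorvallis1979, (4.1.6)] -/
theorem eulerFactor_eq_one_of_eq_bot (hn : absInertia_normal F)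
    (hex : exists_isFrobPow (F := F)) (r : WeilDeligneRep F ℂ W)
    (h : r.inertiaInvariantsKerN = ⊥) : r.eulerFactor hn hex = 1 := by
  -- adapted from `Hida2000Thm326.eulerFactor_eq_one_of_inertiaInvariantsKerN_eq_bot`
  have h0 : finrank ℂ r.inertiaInvariantsKerN = 0 := by rw [h, finrank_bot]
  haveI : IsEmpty (Fin (finrank ℂ r.inertiaInvariantsKerN)) := by
    rw [h0]; infer_instance
  unfold WeilDeligneRep.eulerFactor
  rw [Matrix.charpolyRev]
  exact Matrix.det_isEmpty

/-- The reversed characteristic polynomial of a `1 × 1` matrix `(c)` is `1 - c T`. [folklore] -/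
theorem charpolyRev_fin_one (M : Matrix (Fin 1) (Fin 1) ℂ) :
    M.charpolyRev = 1 - C (M 0 0) * X := by
  rw [Matrix.charpolyRev, Matrix.det_fin_one, Matrix.sub_apply, Matrix.one_apply_eq,
    Matrix.smul_apply, Matrix.map_apply, smul_eq_mul, mul_comm]

/-- **Euler factor of a scalar line with everything unramified.**  If `W_F` acts on `W` by
scalars `ρ(w) = c(w) • id`, `(ker N)^{I_F} = W` and `dim W = 1`, then
`eulerFactor = 1 - c(Φ) T` for the chosen geometric Frobenius `Φ = geomFrob F hex`.
[cite: TateCorvallis1979, (4.1.6)] -/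
theorem eulerFactor_eq_of_smul_of_eq_top (hn : absInertia_normal F)
    (hex : exists_isFrobPow (F := F)) (r : WeilDeligneRep F ℂ W) (c : WeilGroup F → ℂ)
    (hρ : ∀ (w : WeilGroup F) (v : W), r.ρ w v = c w • v) (htop : r.inertiaInvariantsKerN = ⊤)
    (hW : finrank ℂ W = 1) :
    r.eulerFactor hn hex = 1 - C (c (WeilDeligneRep.geomFrob F hex)) * X := by
  have h1 : finrank ℂ r.inertiaInvariantsKerN = 1 := by rw [htop, finrank_top, hW]
  let b : Basis (Fin 1) ℂ r.inertiaInvariantsKerN := finBasisOfFinrankEq ℂ _ h1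
  rw [r.eulerFactor_eq_charpolyRev_toMatrix hn hex (WeilDeligneRep.deg_geomFrob' hex) b,
    charpolyRev_fin_one, LinearMap.toMatrix_apply]
  have hb : r.restrictInertiaInvariantsKerN hn (WeilDeligneRep.geomFrob F hex) (b 0) =
      c (WeilDeligneRep.geomFrob F hex) • b 0 :=
    Subtype.ext (by
      rw [WeilDeligneRep.coe_restrictInertiaInvariantsKerN_apply, hρ, Submodule.coe_smul])
  rw [hb, map_smul, Finsupp.smul_apply, b.repr_self, Finsupp.single_eq_same, smul_eq_mul, mul_one]

omit [FiniteDimensional ℂ W] in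
/-- **A scalar line on which inertia acts non-trivially has `(ker N)^{I_F} = 0`.**  If `W_F` acts
on `W` by scalars `c(w)` and `c(u) ≠ 1` for some `u ∈ I_F`, no non-zero vector is
inertia-invariant. [cite: TateCorvallis1979, (4.1.6)] -/
theorem inertiaInvariantsKerN_eq_bot_of_smul (r : WeilDeligneRep F ℂ W) (c : WeilGroup F → ℂ)
    (hρ : ∀ (w : WeilGroup F) (v : W), r.ρ w v = c w • v) {u : WeilGroup F}
    (hu : u ∈ WeilGroup.inertia F) (hcu : c u ≠ 1) : r.inertiaInvariantsKerN = ⊥ := by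
  rw [eq_bot_iff]
  intro z hz
  rw [Submodule.mem_bot]
  have h1 := ((r.mem_inertiaInvariantsKerN_iff z).1 hz).2 u hu
  rw [hρ] at h1
  have h2 : (c u - 1) • z = 0 := by rw [sub_smul, one_smul, h1, sub_self]
  rcases smul_eq_zero.1 h2 with h | h
  · exact absurd (sub_eq_zero.1 h) hcu
  · exact h

end ScalarLine

/-- `|x|_F = 1` implies `v(x) = 1` (`|·|_F ≤ 1 ↔ · ∈ 𝒪`, `|·|_F < 1 ↔ v · < 1`). [folklore] -/
theorem valuation_eq_one_of_normAbs_eq_one {x : F} (hx : normAbs F x = 1) :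
    ValuativeRel.valuation F x = 1 := by
  refine le_antisymm ?_ (not_lt.1 fun hlt => ?_)
  · exact (Valuation.mem_integer_iff _ _).1
      (IsNonarchimedeanLocalField.normAbs_le_one_iff.1 hx.le)
  · exact (lt_irrefl (1 : NNReal)) (hx ▸ IsNonarchimedeanLocalField.normAbs_lt_one_iff.2 hlt)

/-- A ramified quasi-character is non-trivial on `artin u` for some `u` in the inertia group
(`artin(I_F) = 𝒪ˣ ⊇ {x | |x|_F = 1}`). [folklore] -/
theorem exists_mem_inertia_apply_artin_ne_one (d : LocalArtinData F) {η : QuasiChar F}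
    (hη : ¬ η.IsUnramified) : ∃ u ∈ WeilGroup.inertia F, η (d.artin u) ≠ 1 := by
  obtain ⟨x, hx, hx1⟩ : ∃ x : Fˣ, normAbs F (x : F) = 1 ∧ η x ≠ 1 := by
    by_contra h
    exact hη fun x hx => by_contra fun hx1 => h ⟨x, hx, hx1⟩
  have hxu : x ∈ (ValuativeRel.valuation F).valuationSubring.unitGroup := by
    rw [Valuation.mem_unitGroup_iff]
    exact valuation_eq_one_of_normAbs_eq_one hx
  rw [← d.image_inertia, Subgroup.mem_map] at hxu
  obtain ⟨u, hu, rfl⟩ := hxu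
  exact ⟨u, hu, hx1⟩

/-- **Stub W2-D: the Euler factor of a product of two quasi-character lines** is Tate's
`P_{αχ}` (`1 - (αχ)(ϖ) X` if `αχ` is unramified, `1` otherwise): `W_F` acts on the line
`V ⊗ V₁` by `(αχ) ∘ artin`, inertia-invariants are the whole line iff `αχ` is trivial on
`artin(I_F) = 𝒪ˣ`, and `artin Φ` is a uniformiser for the geometric Frobenius `Φ`
(`tateEulerFactor_of_isUnramified_holds`).
[cite: TateCorvallis1979, (4.1.6)] [cite: Tate1950, §2.4] -/
theorem stub_eulerFactor_ofQuasiCharOn_tprod (hn : absInertia_normal F)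
    (hex : @exists_isFrobPow F _ _ _ _)
    (hns : @WeilGroup.exists_subgroup_le_inertia_isOpen_of_continuous F _ _ _ _)
    (d : LocalArtinData F)
    {V : Type*} [AddCommGroup V] [Module ℂ V] [FiniteDimensional ℂ V]
    {V₁ : Type*} [AddCommGroup V₁] [Module ℂ V₁] [FiniteDimensional ℂ V₁]
    (hV : finrank ℂ V = 1) (hV₁ : finrank ℂ V₁ = 1) (α χ : QuasiChar F) :
    ((WeilDeligneRep.ofQuasiCharOn V hns d α).tprod (WeilDeligneRep.ofQuasiCharOn V₁ hns d χ)).eulerFactor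
      hn hex = tateEulerFactor (α * χ) := by
  set r := (WeilDeligneRep.ofQuasiCharOn V hns d α).tprod (WeilDeligneRep.ofQuasiCharOn V₁ hns d χ)
    with hr
  -- the monodromy of the product line vanishes
  have hN : ∀ z, r.N z = 0 := fun z => by
    rw [hr, WeilDeligneRep.tprod_N, WeilDeligneRep.ofQuasiCharOn_N, WeilDeligneRep.ofQuasiCharOn_N,
      TensorProduct.map_zero_left, TensorProduct.map_zero_right, add_zero, LinearMap.zero_apply]
  -- `W_F` acts on the product line by the scalar `(αχ)(artin w)`
  have hρ : ∀ (w : WeilGroup F) (z : V ⊗[ℂ] V₁),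
      r.ρ w z = (((α * χ) (d.artin w) : ℂˣ) : ℂ) • z := fun w z => by
    induction z using TensorProduct.induction_on with
    | zero => rw [map_zero, smul_zero]
    | tmul a b =>
        rw [hr, WeilDeligneRep.tprod_ρ_apply, TensorProduct.map_tmul,
          WeilDeligneRep.ofQuasiCharOn_ρ_apply, WeilDeligneRep.ofQuasiCharOn_ρ_apply,
          TensorProduct.smul_tmul_smul, ContinuousMonoidHom.mul_apply, Units.val_mul]
    | add x y hx hy => rw [map_add, hx, hy, smul_add]
  by_cases hur : (α * χ).IsUnramified
  · -- unramified: `(ker N)^{I_F}` is the whole line and `artin Φ` is a uniformiser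
    have htop : r.inertiaInvariantsKerN = ⊤ := by
      rw [eq_top_iff]
      rintro z -
      rw [WeilDeligneRep.mem_inertiaInvariantsKerN_iff]
      refine ⟨hN z, fun u hu => ?_⟩
      rw [hρ, hur _ (EpsilonTwist.normAbs_artin_of_mem_inertia d hu), Units.val_one, one_smul]
    have hfr : finrank ℂ (V ⊗[ℂ] V₁) = 1 := by rw [finrank_tensorProduct, hV, hV₁]
    rw [eulerFactor_eq_of_smul_of_eq_top hn hex r _ hρ htop hfr,
      tateEulerFactor_of_isUnramified_holds hur
        (d.artin_frob (WeilDeligneRep.geomFrob F hex) (WeilDeligneRep.deg_geomFrob' hex)),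
      Units.mk0_val]
  · -- ramified: inertia acts non-trivially on the line, `(ker N)^{I_F} = 0`
    obtain ⟨u, hu, hcu⟩ := exists_mem_inertia_apply_artin_ne_one d hur
    rw [tateEulerFactor_of_not_isUnramified hur]
    refine eulerFactor_eq_one_of_eq_bot hn hex r
      (inertiaInvariantsKerN_eq_bot_of_smul r _ hρ hu ?_)
    exact fun h => hcu (Units.val_eq_one.1 h)

end Summit.Langlands.Langlands.Theorems.ReciprocityRigidity

end
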